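import Literature.AnabelianGeometry.AbsoluteAnabelian.ArchimedeanLogFrobenius
import Mathlib.Analysis.SpecialFunctions.Exponential
import Mathlib.Analysis.SpecialFunctions.Complex.Log
import HarnessLib

/-!
# [AbsTopIII] §4: the universal covering `k~ ↠ k^×` of a CAF and Lemma 4.4 for an arbitrary CAF

Mochizuki, *Topics in Absolute Anabelian Geometry III*, §4, Definition 4.1 (i) p. 101 and Lemma 4.4
p. 107 of the author's kurims manuscript (lit key `paper:url-5493eb38cbb7`; bib key
`MochizukiAbsTopIII2015`).  PROOF-ONLY file (abc-iut cell; sub-DAG `AbsTopIII:Cor4.5 (i)(iv)(v)`,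
row `C45-L02b` of plan/L4/SUBDAG-AbsTopIII-Cor45.md; seat abc-iut-w5-d210).  No new notion is
declared: everything is stated over the tree's `IsCAF` (`FundamentalExtension.lean`: "a topological
field that is isomorphic to the field of complex numbers", [AbsTopIII] §0 p. 25) and the tree's
REALISATION `univCover k := NormedSpace.exp` of the universal covering `k~ ↠ k^×` of Def. 4.1 (i)
(`ArchimedeanLogFrobenius.lean`, seat abc-iut-L4-t2 / abc-iut-L4-t14: `k~ = (k, +)`, `log_k = id`).

* `IsCAF.charZero` — a CAF has characteristic zero.
* `IsCAF.univCover_symm_apply` / `IsCAF.univCover_eq` — **the realisation is the complex exponential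
  read through any bicontinuous field isomorphism `e : k ⥲ ℂ`**: `exp_k (e⁻¹ z) = e⁻¹ (exp z)`,
  `exp_k x = e⁻¹ (exp (e x))` (Mathlib `NormedSpace.map_exp`: continuous ring homomorphisms commute
  with the exponential series; `Complex.exp_eq_exp_ℂ`).  Consequently the printed properties of the
  universal covering hold for the realisation: `univCover_zero`, `univCover_add` (a homomorphism
  `(k,+) → k^×`), `univCover_ne_zero`, `univCover_surjective_ne_zero` ("`k~ ↠ k^×`" is onto `k^×`),
  and `univCover_not_injective` / `exists_ne_univCover_eq` (it is NOT injective, indeed not injective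
  on `k ∖ {0}`: the kernel contains `e⁻¹(2πiℤ)`).
* `lemma44_of_isCAF` — **Lemma 4.4 for an ARBITRARY CAF** `k`: "no composite of the form
  `k^× →α (k~)^× ↪ k~ ↠ k^×` — where the `×` of `(k~)^×` is relative to the field structure of `k~`;
  `α` is an isomorphism of topological groups; `↪` is the natural inclusion; `↠` is the natural map —
  is bijective" (indeed not injective: `lemma44_not_injective_of_isCAF`), by the printed argument "the
  non-injectivity of `k~ ↠ k^×` implies that the composite under consideration fails to be
  injective".  With `k~ = (k,+)` carrying the field structure of `k` (so `(k~)^× = k^×` and `↪` is the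
  coercion `k^× → k`) the composite is `z ↦ exp_k (α z)`.  abc-iut-L4-t14's staged
  `addMulDistinguishableArch` is the case `k = ℂ`, `exp_k = Complex.exp`; `lemma44_complex` below
  recovers exactly that statement from the general one.

Classical (complex exponential); refereed pre-IUT material; nothing here bears on [IUTchIII]
Cor. 3.12 or takes a side; typed ≠ discharged for anything not proved here.
-/

namespace Literature.AnabelianGeometry.AbsoluteAnabelian

open _root_.Complex

universe u

noncomputable section

namespace IsCAF

variable {k : Type u} [NormedField k]

/-- A CAF has characteristic zero (it is field-isomorphic to `ℂ`).
[cite: MochizukiAbsTopIII2015, §0 p.25] -/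
theorem charZero (hk : IsCAF k) : CharZero k := by
  obtain ⟨e, -, -⟩ := hk.exists_equiv
  exact e.toRingHom.charZero

/-- **The realised universal covering is the complex exponential, read through a bicontinuous field
isomorphism** `e : k ⥲ ℂ`: `exp_k (e⁻¹ z) = e⁻¹ (exp z)` — continuous ring homomorphisms commute with
the exponential series. [cite: MochizukiAbsTopIII2015, Definition 4.1 (i) p.101] -/
theorem univCover_symm_apply [CharZero k] (e : k ≃+* ℂ) (he : Continuous e.symm) (z : ℂ) :
    univCover k (e.symm z) = e.symm (Complex.exp z) := by
  unfold univCover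
  rw [Complex.exp_eq_exp_ℂ]
  exact (NormedSpace.map_exp e.symm he z).symm

/-- `exp_k x = e⁻¹ (exp (e x))` for any bicontinuous field isomorphism `e : k ⥲ ℂ`.
[cite: MochizukiAbsTopIII2015, Definition 4.1 (i) p.101] -/
theorem univCover_eq [CharZero k] (e : k ≃+* ℂ) (he : Continuous e.symm) (x : k) :
    univCover k x = e.symm (Complex.exp (e x)) := by
  rw [← univCover_symm_apply e he (e x), RingEquiv.symm_apply_apply]

/-- `exp_k 0 = 1`. [cite: MochizukiAbsTopIII2015, Definition 4.1 (i) p.101] -/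
theorem univCover_zero [CharZero k] (hk : IsCAF k) : univCover k 0 = 1 := by
  obtain ⟨e, -, he⟩ := hk.exists_equiv
  rw [univCover_eq e he, map_zero, Complex.exp_zero, map_one]

/-- **`k~ → k^×` is a homomorphism** from `(k~, +) = (k, +)` to the multiplicative structure ("the
pointed topological space `k~` admits a natural topological group structure", Def. 4.1 (i)):
`exp_k (x + y) = exp_k x · exp_k y`. [cite: MochizukiAbsTopIII2015, Definition 4.1 (i) p.101] -/
theorem univCover_add [CharZero k] (hk : IsCAF k) (x y : k) :
    univCover k (x + y) = univCover k x * univCover k y := by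
  obtain ⟨e, -, he⟩ := hk.exists_equiv
  rw [univCover_eq e he, univCover_eq e he, univCover_eq e he, map_add, Complex.exp_add, map_mul]

/-- `exp_k` takes values in `k^×`: `exp_k x ≠ 0`. [cite: MochizukiAbsTopIII2015, Definition 4.1 (i) p.101] -/
theorem univCover_ne_zero [CharZero k] (hk : IsCAF k) (x : k) : univCover k x ≠ 0 := by
  obtain ⟨e, -, he⟩ := hk.exists_equiv
  rw [univCover_eq e he, map_ne_zero_iff _ e.symm.injective]
  exact Complex.exp_ne_zero _

/-- **"`k~ ↠ k^×`" is surjective onto `k^×`**: every nonzero element of a CAF is an exponential.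
[cite: MochizukiAbsTopIII2015, Definition 4.1 (i) p.101] -/
theorem univCover_surjective_ne_zero [CharZero k] (hk : IsCAF k) {y : k} (hy : y ≠ 0) :
    ∃ x : k, univCover k x = y := by
  obtain ⟨e, -, he⟩ := hk.exists_equiv
  refine ⟨e.symm (Complex.log (e y)), ?_⟩
  rw [univCover_symm_apply e he, Complex.exp_log ((map_ne_zero_iff _ e.injective).mpr hy),
    RingEquiv.symm_apply_apply]

/-- The realised covering map as a map onto the units `k^×` of a CAF.
[cite: MochizukiAbsTopIII2015, Definition 4.1 (i) p.101] -/
theorem univCover_surjective_units [CharZero k] (hk : IsCAF k) (u : kˣ) :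
    ∃ x : k, univCover k x = (u : k) :=
  univCover_surjective_ne_zero hk u.ne_zero

/-- The kernel of `exp_k` contains `e⁻¹(2πi n)` for every integer `n`.
[cite: MochizukiAbsTopIII2015, Definition 4.1 (i) p.101] -/
theorem univCover_symm_two_pi_I_mul [CharZero k] (e : k ≃+* ℂ) (he : Continuous e.symm) (n : ℤ) :
    univCover k (e.symm (n * (2 * Real.pi * Complex.I))) = 1 := by
  rw [univCover_symm_apply e he, Complex.exp_eq_one_iff.mpr ⟨n, rfl⟩, map_one]

/-- **`k~ ↠ k^×` is not injective** — indeed there are two DISTINCT NONZERO elements of `k` with the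
same exponential (`e⁻¹(2πi)` and `e⁻¹(4πi)`), so it is not injective on `(k~)^× = k ∖ {0}` either; this
is the "non-injectivity of `k~ ↠ k^×`" invoked in the proof of Lemma 4.4.
[cite: MochizukiAbsTopIII2015, Lemma 4.4 p.107] -/
theorem exists_ne_univCover_eq [CharZero k] (hk : IsCAF k) :
    ∃ x y : k, x ≠ 0 ∧ y ≠ 0 ∧ x ≠ y ∧ univCover k x = univCover k y := by
  obtain ⟨e, -, he⟩ := hk.exists_equiv
  have hπ : (2 * Real.pi * Complex.I : ℂ) ≠ 0 := by
    simp [Complex.ext_iff, Real.pi_ne_zero]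
  refine ⟨e.symm ((1 : ℤ) * (2 * Real.pi * Complex.I)), e.symm ((2 : ℤ) * (2 * Real.pi * Complex.I)),
    ?_, ?_, ?_, ?_⟩
  · rw [map_ne_zero_iff _ e.symm.injective, Int.cast_one, one_mul]; exact hπ
  · rw [map_ne_zero_iff _ e.symm.injective, Int.cast_two]; exact mul_ne_zero two_ne_zero hπ
  · intro h
    have h' := e.symm.injective h
    rw [Int.cast_one, one_mul, Int.cast_two] at h'
    exact hπ (by linear_combination -h')
  · rw [univCover_symm_two_pi_I_mul e he, univCover_symm_two_pi_I_mul e he]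

/-- `exp_k` is not injective on a CAF. [cite: MochizukiAbsTopIII2015, Lemma 4.4 p.107] -/
theorem univCover_not_injective [CharZero k] (hk : IsCAF k) : ¬ Function.Injective (univCover k) := by
  obtain ⟨x, y, -, -, hxy, h⟩ := exists_ne_univCover_eq hk
  exact fun hinj => hxy (hinj h)

/-- **Lemma 4.4 (Topological Distinguishability of Additive and Multiplicative Structures), for an
arbitrary CAF `k`, injectivity form**: for every isomorphism of topological groups
`α : k^× ⥲ (k~)^×` (`(k~)^× = k^×`, the `×` being relative to the field structure of `k~ = k`), the
composite `k^× →α (k~)^× ↪ k~ ↠ k^×`, `z ↦ exp_k (α z)`, is NOT injective — "the non-injectivity of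
`k~ ↠ k^×` implies that the composite under consideration fails to be injective".
[cite: MochizukiAbsTopIII2015, Lemma 4.4 p.107] -/
theorem lemma44_not_injective_of_isCAF [CharZero k] (hk : IsCAF k) (α : kˣ ≃ₜ* kˣ) :
    ¬ Function.Injective (fun z : kˣ => univCover k ((α z : kˣ) : k)) := by
  intro hinj
  obtain ⟨x, y, hx, hy, hxy, h⟩ := exists_ne_univCover_eq hk
  obtain ⟨zx, hzx⟩ := α.surjective (Units.mk0 x hx)
  obtain ⟨zy, hzy⟩ := α.surjective (Units.mk0 y hy)
  have hz : zx = zy := hinj (by simp only [hzx, hzy, Units.val_mk0, h])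
  apply hxy
  have : (Units.mk0 x hx : kˣ) = Units.mk0 y hy := by rw [← hzx, ← hzy, hz]
  simpa using congrArg Units.val this

/-- **Lemma 4.4 for an arbitrary CAF `k`** (printed form): no composite
`k^× →α (k~)^× ↪ k~ ↠ k^×` with `α` an isomorphism of topological groups is bijective.
[cite: MochizukiAbsTopIII2015, Lemma 4.4 p.107] -/
theorem lemma44_of_isCAF [CharZero k] (hk : IsCAF k) (α : kˣ ≃ₜ* kˣ) :
    ¬ Function.Bijective (fun z : kˣ => univCover k ((α z : kˣ) : k)) :=
  fun h => lemma44_not_injective_of_isCAF hk α h.1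

end IsCAF

/-- `ℂ` is a CAF. [cite: MochizukiAbsTopIII2015, §0 p.25] -/
theorem isCAF_complex : IsCAF ℂ :=
  ⟨⟨RingEquiv.refl ℂ, continuous_id, continuous_id⟩⟩

/-- On `ℂ` the realised universal covering IS `Complex.exp`.
[cite: MochizukiAbsTopIII2015, Definition 4.1 (i) p.101] -/
theorem univCover_complex (z : ℂ) : univCover ℂ z = Complex.exp z := by
  unfold univCover
  rw [Complex.exp_eq_exp_ℂ]

/-- **Lemma 4.4 for `k = ℂ`** in the shape of abc-iut-L4-t14's `AddMulDistinguishableArch` (staged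
`ArchimedeanLogFrobeniusFunctors.lean`): for every `α : ℂ^× ⥲ ℂ^×` (topological groups),
`z ↦ exp (α z)` is not bijective — the special case of `IsCAF.lemma44_of_isCAF`.
[cite: MochizukiAbsTopIII2015, Lemma 4.4 p.107] -/
theorem lemma44_complex (α : ℂˣ ≃ₜ* ℂˣ) :
    ¬ Function.Bijective (fun z : ℂˣ => Complex.exp ((α z : ℂˣ) : ℂ)) := by
  have h := IsCAF.lemma44_of_isCAF isCAF_complex α
  simpa only [univCover_complex] using h

end

end Literature.AnabelianGeometry.AbsoluteAnabelian
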